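/-
Copyright (c) 2026. All rights reserved.
Released under Apache 2.0 license as described in the file LICENSE.
Authors: abc-iut cell, seat abc-iut-f-069 (gen 4; row «DPSC-NODAL-MODEL»).
-/
import Mathlib.GroupTheory.FreeGroup.Basic
import Mathlib.GroupTheory.SemidirectProduct
import Mathlib.Data.ZMod.Basic
import Mathlib.Tactic.Group
import Mathlib.Tactic.FinCases
import HarnessLib

/-!
# The index-two subgroup `⟨b, aba⁻¹, a²⟩` of the free group `F(a,b)` is free on these three elements

Lyndon–Schupp, *Combinatorial Group Theory*, Ch. I §3 (Nielsen–Schreier; Schreier transversals and the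
Schreier basis of a finite-index subgroup of a free group) [cite: LyndonSchupp2001, Ch. I Prop. 3.9]: for
`F = F(a, b)` and the homomorphism `χ : F → ℤ/2`, `a ↦ 1`, `b ↦ 0`, the kernel `U = Ker χ` (index `2`, Schreier
transversal `{1, a}`) is free on the Schreier basis `{b, a b a⁻¹, a²}`.

PROOF-ONLY (no definition), abc-iut-f-069 (gen 4).  Used by the abc-iut cell's nodal Dehn-twist model of
[AbsTopII] Prop 1.3 (`AbsTopII/DehnTwist*`): the verticial subgroup `Π_v = ⟨b, aba⁻¹⟩^ ⊆ F̂₂` is the closure of a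
FREE FACTOR of `Û`, which makes layer L3's free-factor malnormality (`freeFactor_isCommensurablyTerminal`)
applicable.  Route (ours, no Reidemeister–Schreier rewriting): the assignment
`a ↦ ((1, z), swap)`, `b ↦ ((x, y), 1)` defines `Ψ : F(a,b) → (F₃ × F₃) ⋊ Aut` (`F₃ = F(x,y,z)`), and with
`θ : x ↦ y, y ↦ z x z⁻¹, z ↦ z` (so `θ² = conj z`) and `j : x ↦ b, y ↦ aba⁻¹, z ↦ a²` one proves by induction on
words the normal form `Ψ g = ((w, θ w), 1), g = j w` or `Ψ g = ((w, θ(w) z), swap), g = j(w)·a`; hence `j` is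
injective (`Ψ ∘ j = (id, θ)`) and `j(F₃) = Ker χ`.

* `freeGroupTwo_indexTwo_basis` — **∃ an injective `j : F₃ →* F₂` with `j x = b`, `j y = aba⁻¹`, `j z = a²` and
  `range j = Ker χ`.**
Classical combinatorial group theory; nothing here bears on [IUTchIII] Cor 3.12.
-/

namespace Literature.GroupTheory.CombinatorialGroupTheory

open FreeGroup (of)

/-- The character `χ : F(a,b) → ℤ/2`, `a ↦ 1`, `b ↦ 0`, kills `b`, `aba⁻¹` and `a²`.
[cite: LyndonSchupp2001, Ch. I Prop. 3.9] -/
theorem lift_chi_apply_generators :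
    let χ : FreeGroup (Fin 2) →* Multiplicative (ZMod 2) :=
      FreeGroup.lift fun i => if i = 0 then Multiplicative.ofAdd 1 else 1
    χ (of 1) = 1 ∧ χ (of 0 * of 1 * (of 0)⁻¹) = 1 ∧ χ (of 0 * of 0) = 1 ∧ χ (of 0) = Multiplicative.ofAdd 1 := by
  intro χ
  have h0 : χ (of 0) = Multiplicative.ofAdd 1 := by simp [χ]
  have h1 : χ (of 1) = 1 := by simp [χ]
  refine ⟨h1, by rw [map_mul, map_mul, map_inv, h0, h1]; group, ?_, h0⟩
  rw [map_mul, h0, ← ofAdd_add]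
  rfl

/-- **The Schreier basis of `Ker(F(a,b) → ℤ/2)`.**  There is an INJECTIVE homomorphism
`j : F(x,y,z) → F(a,b)` with `x ↦ b`, `y ↦ a b a⁻¹`, `z ↦ a²`, whose image is exactly the kernel of
`χ : a ↦ 1, b ↦ 0` (so `U = ⟨b, aba⁻¹, a²⟩` is free of rank `3` on these generators and has index `2`).
[cite: LyndonSchupp2001, Ch. I Prop. 3.9] -/
theorem freeGroupTwo_indexTwo_basis :
    ∃ j : FreeGroup (Fin 3) →* FreeGroup (Fin 2),
      Function.Injective j ∧ j (of 0) = of 1 ∧ j (of 1) = of 0 * of 1 * (of 0)⁻¹ ∧ j (of 2) = of 0 * of 0 ∧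
      j.range = (FreeGroup.lift fun i : Fin 2 =>
        if i = 0 then Multiplicative.ofAdd (1 : ZMod 2) else 1).ker := by
  classical
  -- the three generators of `F₃` and their images
  let x : FreeGroup (Fin 3) := of 0
  let y : FreeGroup (Fin 3) := of 1
  let z : FreeGroup (Fin 3) := of 2
  let a : FreeGroup (Fin 2) := of 0
  let b : FreeGroup (Fin 2) := of 1
  let j : FreeGroup (Fin 3) →* FreeGroup (Fin 2) := FreeGroup.lift fun i => if i = 0 then b else if i = 1 then a * b * a⁻¹ else a * a
  have hjx : j x = b := by simp [j, x]
  have hjy : j y = a * b * a⁻¹ := by simp [j, y]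
  have hjz : j z = a * a := by simp [j, z]
  -- `θ : x ↦ y, y ↦ z x z⁻¹, z ↦ z`
  let θ : FreeGroup (Fin 3) →* FreeGroup (Fin 3) := FreeGroup.lift fun i => if i = 0 then y else if i = 1 then z * x * z⁻¹ else z
  have hθx : θ x = y := by simp [θ, x]
  have hθy : θ y = z * x * z⁻¹ := by simp [θ, y]
  have hθz : θ z = z := by simp [θ, z]
  -- `θ ∘ θ = conj z`
  have hθθ : ∀ w, θ (θ w) = z * w * z⁻¹ := by
    intro w
    have h : θ.comp θ = (MulAut.conj z).toMonoidHom := by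
      refine FreeGroup.ext_hom _ _ fun i => ?_
      fin_cases i
      · change θ (θ x) = z * x * z⁻¹
        rw [hθx, hθy]
      · change θ (θ y) = z * y * z⁻¹
        rw [hθy, map_mul, map_mul, map_inv, hθz, hθx]
      · change θ (θ z) = z * z * z⁻¹
        rw [hθz, hθz, mul_inv_cancel_right]
    exact DFunLike.congr_fun h w
  -- `j ∘ θ = conj a ∘ j`
  have hjθ : ∀ w, j (θ w) = a * j w * a⁻¹ := by
    intro w
    have h : j.comp θ = (MulAut.conj a).toMonoidHom.comp j := by
      refine FreeGroup.ext_hom _ _ fun i => ?_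
      fin_cases i
      · change j (θ x) = a * j x * a⁻¹
        rw [hθx, hjy, hjx]
      · change j (θ y) = a * j y * a⁻¹
        rw [hθy, map_mul, map_mul, map_inv, hjz, hjx, hjy]; group
      · change j (θ z) = a * j z * a⁻¹
        rw [hθz, hjz]; group
    exact DFunLike.congr_fun h w
  -- the ambient group `(F₃ × F₃) ⋊ Aut` and the swap
  let N := FreeGroup (Fin 3) × FreeGroup (Fin 3)
  let σ : MulAut N := MulEquiv.prodComm
  have hσσ : σ * σ = 1 := by ext p <;> rfl
  have hσ_apply : ∀ p q : FreeGroup (Fin 3), σ (p, q) = (q, p) := fun _ _ => rfl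
  let W := N ⋊[MonoidHom.id (MulAut N)] MulAut N
  let Ψ : FreeGroup (Fin 2) →* W :=
    FreeGroup.lift fun i => if i = 0 then SemidirectProduct.inl ((1 : FreeGroup (Fin 3)), z) * SemidirectProduct.inr σ
      else SemidirectProduct.inl (x, y)
  have hΨa : Ψ a = SemidirectProduct.inl ((1 : FreeGroup (Fin 3)), z) * SemidirectProduct.inr σ := by
    simp [Ψ, a]
  have hΨb : Ψ b = SemidirectProduct.inl (x, y) := by simp [Ψ, b]
  -- the two normal forms
  let E₀ : FreeGroup (Fin 3) → W := fun w => SemidirectProduct.inl (w, θ w)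
  let E₁ : FreeGroup (Fin 3) → W := fun w => SemidirectProduct.inl (w, θ w * z) * SemidirectProduct.inr σ
  -- products of normal forms
  have m00 : ∀ w w', E₀ w * E₀ w' = E₀ (w * w') := by
    intro w w'
    change SemidirectProduct.inl _ * SemidirectProduct.inl _ = SemidirectProduct.inl _
    rw [← map_mul, Prod.mk_mul_mk, ← map_mul]
  have m01 : ∀ w w', E₀ w * E₁ w' = E₁ (w * w') := by
    intro w w'
    change SemidirectProduct.inl _ * (SemidirectProduct.inl _ * _) = SemidirectProduct.inl _ * _
    rw [← mul_assoc, ← map_mul, Prod.mk_mul_mk, map_mul, mul_assoc]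
  have key : ∀ p q : FreeGroup (Fin 3), (SemidirectProduct.inr σ : W) * SemidirectProduct.inl (p, q) =
      SemidirectProduct.inl (q, p) * SemidirectProduct.inr σ := by
    intro p q
    have h := (SemidirectProduct.inl_aut (φ := MonoidHom.id (MulAut N)) σ (p, q))
    rw [MonoidHom.id_apply, hσ_apply] at h
    rw [h, map_inv, inv_mul_cancel_right]
  have m10 : ∀ w w', E₁ w * E₀ w' = E₁ (w * θ w') := by
    intro w w'
    change SemidirectProduct.inl _ * SemidirectProduct.inr σ * SemidirectProduct.inl _ =
      SemidirectProduct.inl _ * SemidirectProduct.inr σ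
    rw [mul_assoc, key, ← mul_assoc, ← map_mul, Prod.mk_mul_mk, map_mul, hθθ]
    congr 3
    group
  have m11 : ∀ w w', E₁ w * E₁ w' = E₀ (w * θ w' * z) := by
    intro w w'
    change SemidirectProduct.inl _ * SemidirectProduct.inr σ * (SemidirectProduct.inl _ * SemidirectProduct.inr σ) =
      SemidirectProduct.inl _
    rw [← mul_assoc, mul_assoc (SemidirectProduct.inl _), key, ← mul_assoc, ← map_mul, Prod.mk_mul_mk, mul_assoc,
      ← map_mul, hσσ, map_one, mul_one, map_mul, map_mul, hθθ, hθz]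
    congr 2
    group
  have hΨa' : Ψ a = E₁ 1 := by
    change Ψ a = SemidirectProduct.inl (1, θ 1 * z) * SemidirectProduct.inr σ
    rw [map_one, one_mul, hΨa]
  have hΨb' : Ψ b = E₀ x := by
    change Ψ b = SemidirectProduct.inl (x, θ x)
    rw [hθx, hΨb]
  -- the invariant, by induction on words
  have Q : ∀ g : FreeGroup (Fin 2), ∃ w, (Ψ g = E₀ w ∧ g = j w) ∨ (Ψ g = E₁ w ∧ g = j w * a) := by
    intro g
    induction g using FreeGroup.induction_on with
    | C1 => exact ⟨1, Or.inl ⟨by change (1 : W) = SemidirectProduct.inl (1, θ 1); rw [map_one]; rfl, by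
        rw [map_one]⟩⟩
    | of i =>
      fin_cases i
      · refine ⟨1, Or.inr ⟨hΨa', ?_⟩⟩
        change a = j 1 * a
        rw [map_one, one_mul]
      · refine ⟨x, Or.inl ⟨hΨb', ?_⟩⟩
        change b = j x
        rw [hjx]
    | inv_of i ih =>
      fin_cases i
      · refine ⟨z⁻¹, Or.inr ⟨?_, ?_⟩⟩
        · change (Ψ a)⁻¹ = SemidirectProduct.inl (z⁻¹, θ z⁻¹ * z) * SemidirectProduct.inr σ
          rw [map_inv, hθz, inv_mul_cancel, hΨa, mul_inv_rev, ← map_inv, ← map_inv, Prod.inv_mk, inv_one,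
            inv_eq_of_mul_eq_one_right hσσ, key]
        · change a⁻¹ = j z⁻¹ * a
          rw [map_inv, hjz]; group
      · refine ⟨x⁻¹, Or.inl ⟨?_, ?_⟩⟩
        · change (Ψ b)⁻¹ = SemidirectProduct.inl (x⁻¹, θ x⁻¹)
          rw [map_inv, hθx, hΨb, ← map_inv, Prod.inv_mk]
        · change b⁻¹ = j x⁻¹
          rw [map_inv, hjx]
    | mul g h ihg ihh =>
      obtain ⟨w, hg⟩ := ihg
      obtain ⟨w', hh⟩ := ihh
      rcases hg with ⟨hg1, hg2⟩ | ⟨hg1, hg2⟩ <;> rcases hh with ⟨hh1, hh2⟩ | ⟨hh1, hh2⟩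
      · exact ⟨w * w', Or.inl ⟨by rw [map_mul, hg1, hh1, m00], by rw [hg2, hh2, map_mul]⟩⟩
      · exact ⟨w * w', Or.inr ⟨by rw [map_mul, hg1, hh1, m01], by rw [hg2, hh2, map_mul, mul_assoc]⟩⟩
      · refine ⟨w * θ w', Or.inr ⟨by rw [map_mul, hg1, hh1, m10], ?_⟩⟩
        rw [hg2, hh2, map_mul, hjθ]; group
      · refine ⟨w * θ w' * z, Or.inl ⟨by rw [map_mul, hg1, hh1, m11], ?_⟩⟩
        rw [hg2, hh2, map_mul, map_mul, hjθ, hjz]; group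
  -- `Ψ ∘ j = (id, θ)`: both are homomorphisms agreeing on generators
  have hΨj : ∀ w, Ψ (j w) = E₀ w := by
    intro w
    have h : Ψ.comp j = (SemidirectProduct.inl : N →* W).comp ((MonoidHom.id _).prod θ) := by
      refine FreeGroup.ext_hom _ _ fun i => ?_
      fin_cases i
      · change Ψ (j x) = SemidirectProduct.inl (x, θ x)
        rw [hjx, hΨb, hθx]
      · change Ψ (j y) = E₀ y
        have h1 : Ψ (j y) * Ψ a = E₁ y := by
          rw [← map_mul, hjy, inv_mul_cancel_right, map_mul, hΨa', hΨb', m10, one_mul, hθx]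
        have h2 : E₀ y * Ψ a = E₁ y := by rw [hΨa', m01, mul_one]
        exact mul_right_cancel (h1.trans h2.symm)
      · change Ψ (j z) = E₀ z
        rw [hjz, map_mul, hΨa', m11, map_one, mul_one, one_mul]
    exact DFunLike.congr_fun h w
  refine ⟨j, ?_, hjx, hjy, hjz, ?_⟩
  · -- injectivity
    intro w w' hww
    have h := congrArg Ψ hww
    rw [hΨj, hΨj] at h
    exact (Prod.mk.inj (SemidirectProduct.inl_injective h)).1
  · -- the image is the kernel of `χ`
    obtain ⟨hχb, hχaba, hχaa, hχa⟩ := lift_chi_apply_generators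
    set χ : FreeGroup (Fin 2) →* Multiplicative (ZMod 2) :=
      FreeGroup.lift fun i : Fin 2 => if i = 0 then Multiplicative.ofAdd (1 : ZMod 2) else 1 with hχdef
    have hker : ∀ w, χ (j w) = 1 := by
      intro w
      have h : χ.comp j = 1 := by
        refine FreeGroup.ext_hom _ _ fun i => ?_
        fin_cases i
        · change χ (j x) = 1; rw [hjx]; exact hχb
        · change χ (j y) = 1; rw [hjy]; exact hχaba
        · change χ (j z) = 1; rw [hjz]; exact hχaa
      exact DFunLike.congr_fun h w
    ext g
    constructor
    · rintro ⟨w, rfl⟩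
      rw [MonoidHom.mem_ker]
      exact hker w
    · intro hg
      rw [MonoidHom.mem_ker] at hg
      obtain ⟨w, ⟨-, hw⟩ | ⟨-, hw⟩⟩ := Q g
      · exact ⟨w, hw.symm⟩
      · exfalso
        rw [hw, map_mul] at hg
        rw [hker w, one_mul] at hg
        change χ a = 1 at hg
        rw [hχa] at hg
        exact absurd (Multiplicative.ofAdd.injective hg) (by decide)

end Literature.GroupTheory.CombinatorialGroupTheory
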